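import Summits.ResolutionOfSingularities.ResolutionOfSingularities.Theorems.FrobeniusLadderFInjectiveMacaulayficationRoadBFrame
import Summits.ResolutionOfSingularities.ResolutionOfSingularities.Theorems.FrobeniusLadderFInjectiveMacaulayficationT4Char7FanData
import Summits.ResolutionOfSingularities.ResolutionOfSingularities.Theorems.FrobeniusLadderFInjectiveMacaulayficationT4Char7FanHeavy
import Summits.ResolutionOfSingularities.ResolutionOfSingularities.Theorems.FrobeniusLadderFInjectiveMacaulayficationT4Char7HonBlock0
import Summits.ResolutionOfSingularities.ResolutionOfSingularities.Theorems.FrobeniusLadderFInjectiveMacaulayficationT4Char7HonBlock1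
import Summits.ResolutionOfSingularities.ResolutionOfSingularities.Theorems.FrobeniusLadderFInjectiveMacaulayficationT4Char7HonBlock2
import Summits.ResolutionOfSingularities.ResolutionOfSingularities.Theorems.FrobeniusLadderFInjectiveMacaulayficationT4Char7HonBlock3
import Summits.ResolutionOfSingularities.ResolutionOfSingularities.Theorems.FrobeniusLadderFInjectiveMacaulayficationT4Char7HonBlock4
import Summits.ResolutionOfSingularities.ResolutionOfSingularities.Theorems.FrobeniusLadderFInjectiveMacaulayficationT4Char7Poly
import Summits.ResolutionOfSingularities.ResolutionOfSingularities.Theorems.FrobeniusLadderFInjectiveMacaulayficationT4HypersurfacePrime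
import Summits.ResolutionOfSingularities.ResolutionOfSingularities.Theorems.FrobeniusLadderFInjectiveMacaulayficationT4PlusOriginTransport
import HarnessLib

/-!
# THE ROAD-B INSTANCE `T⁽⁴⁾ / 7`: the origin of `X = V(z² + (y²+x³)³ + w⁷ + v⁸ + x¹²) ⊂ 𝔸⁵_k`, `char k = 7`, is POINT-FIXABLE; HEADLINE = the crux for `T⁽⁴⁾⁺`
# (crux `FInjectiveMacaulayfication`, road B, T⁽⁴⁾/7 instance; res-L1-w45a-plan-1 R12.47 (D4) / R12.54 (7) PLAN B / R13.1; seat res-L1-w45a-stub-1)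

Support file for crux stmt-ResolutionOfSingularities-15315 (`FrobeniusLadder.FInjectiveMacaulayfication`), chain w45a. [OURS · L1 W4.5a] —
NOT a statement of the manuscript [claim: Hironaka2017]; AI-written, weaker than expert review; no statement of the manuscript is used.
GENERATED by `gen_instance_t4.py` (res-L1-w45a-stub-1) from the module/theorem names of record; the mathematics is res-L1-w45a-tri-1's
toric certificate `cert-T4-own-p7.v1.1.json` (537 charts), kernel-checked chart by chart in the cells files `…T4Char7Cells000…T4Char7Cells107` /
`…T4Char7CellsGb<c>` and turned into the per-chart `hon'` by res-D-pv-017's `T4Char7Poly.hon_of_cells` (res-L1-w45a-stub-1's `KLocCellRange` inside).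
No definitions, no named facts. [folklore glue]
-/

-- single-problem summit: the doubled namespace component is forced
set_option linter.dupNamespace false

noncomputable section

open AlgebraicGeometry MvPolynomial

namespace Summit.ResolutionOfSingularities.ResolutionOfSingularities.Theorems.FInjectiveMacaulayfication.T4OriginPointFixableChar7

open Summit.ResolutionOfSingularities.ResolutionOfSingularities.Theorems.FInjectiveMacaulayfication

/-- `hon'` for all 537 charts, joined from the five block files. -/
theorem hon_all (k : Type) [Field k] [CharP k 7] : ∀ c : Fin 537,
    ∀ (Q' : Ideal (MvPolynomial (Fin 5) k ⧸ Ideal.span (Set.range (![KLocCellKit.evalL k (T4Char7Poly.G c)] : Fin 1 → MvPolynomial (Fin 5) k)))) [Q'.IsMaximal],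
      (∀ j ∈ (Finset.univ : Finset (Fin 5)), Ideal.Quotient.mk (Ideal.span (Set.range (![KLocCellKit.evalL k (T4Char7Poly.G c)] : Fin 1 → MvPolynomial (Fin 5) k)))
        (aeval (fun j : Fin 5 => ∏ i : Fin 5, (X i : MvPolynomial (Fin 5) k) ^ T4Char7Fan.V c i j) (X j : MvPolynomial (Fin 5) k)) ∈ Q') →
        (∀ i : Fin 5, (X i : MvPolynomial (Fin 5) k) ∈ Q'.comap (Ideal.Quotient.mk (Ideal.span (Set.range (![KLocCellKit.evalL k (T4Char7Poly.G c)] : Fin 1 → MvPolynomial (Fin 5) k)))) →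
          IsSMulRegular (Localization.AtPrime (Q'.comap (Ideal.Quotient.mk (Ideal.span (Set.range (![KLocCellKit.evalL k (T4Char7Poly.G c)] : Fin 1 → MvPolynomial (Fin 5) k))))) ⧸
              (Ideal.span (Set.range (![KLocCellKit.evalL k (T4Char7Poly.G c)] : Fin 1 → MvPolynomial (Fin 5) k))).map (algebraMap (MvPolynomial (Fin 5) k)
                (Localization.AtPrime (Q'.comap (Ideal.Quotient.mk (Ideal.span (Set.range (![KLocCellKit.evalL k (T4Char7Poly.G c)] : Fin 1 → MvPolynomial (Fin 5) k))))))))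
            (algebraMap (MvPolynomial (Fin 5) k)
              (Localization.AtPrime (Q'.comap (Ideal.Quotient.mk (Ideal.span (Set.range (![KLocCellKit.evalL k (T4Char7Poly.G c)] : Fin 1 → MvPolynomial (Fin 5) k)))))) (X i))) ∧
        ∀ dd : ℕ, ringKrullDim (Localization.AtPrime Q') = dd → ∀ s : Fin dd → Localization.AtPrime Q',
          (Ideal.span (Set.range s)).radical.IsMaximal →
            RingTheory.Sequence.IsWeaklyRegular (Localization.AtPrime Q') (List.ofFn s) ∧
            ∀ y : Localization.AtPrime Q', (∃ e : ℕ, y ^ 7 ^ e ∈ Ideal.span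
              ((fun z : Localization.AtPrime Q' => z ^ 7 ^ e) ''
                (Ideal.span (Set.range s) : Set (Localization.AtPrime Q')))) → y ∈ Ideal.span (Set.range s) := by
  intro c
  rcases Nat.lt_or_ge c.val 110 with h0 | h0
  · exact T4Char7HonBlock0.honBlock k c (Nat.zero_le _) h0
  rcases Nat.lt_or_ge c.val 220 with h1 | h1
  · exact T4Char7HonBlock1.honBlock k c (h0) h1
  rcases Nat.lt_or_ge c.val 330 with h2 | h2
  · exact T4Char7HonBlock2.honBlock k c (h1) h2
  rcases Nat.lt_or_ge c.val 440 with h3 | h3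
  · exact T4Char7HonBlock3.honBlock k c (h2) h3
  · exact T4Char7HonBlock4.honBlock k c h3 c.isLt

/-- **THE ROAD-B INSTANCE `T⁽⁴⁾ / 7`**: for every field `k` of characteristic `7` the origin of
`Spec k[x,y,z,w,v]/(z² + (y²+x³)³ + w⁷ + v⁸ + x¹²)` is point-fixable (`PFix₇`, the `h0` shape of `T4SpecimenDoor`), stated over a variable
`Gs : Fin 1 → k[X]` pinned by `hG` (cheap elaboration). [OURS; folklore glue] -/
theorem t4_originPointFixable_char7 (k : Type) [Field k] [CharP k 7] (Gs : Fin 1 → MvPolynomial (Fin 5) k)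
    (hG : Gs 0 = X 2 ^ 2 + (X 1 ^ 2 + X 0 ^ 3) ^ 3 + X 3 ^ 7 + X 4 ^ 8 + X 0 ^ 12) :
    ∀ b : Spec (.of (MvPolynomial (Fin 5) k ⧸ Ideal.span (Set.range Gs))),
      b.asIdeal = Ideal.span (Set.range fun j : Fin 5 => Ideal.Quotient.mk (Ideal.span (Set.range Gs)) (X j)) →
      ∃ (nc : ℕ) (c : Fin nc → (Spec (.of (MvPolynomial (Fin 5) k ⧸ Ideal.span (Set.range Gs)))).presheaf.stalk b),
        Ideal.span (Set.range c) ≠ ⊥ ∧ (Ideal.span (Set.range c)).radical =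
          IsLocalRing.maximalIdeal ((Spec (.of (MvPolynomial (Fin 5) k ⧸ Ideal.span (Set.range Gs)))).presheaf.stalk b) ∧
        ∀ (j : Fin nc) (𝔔 : PrimeSpectrum (Literature.AlgebraicGeometry.Resolution.blowupAlgebra (Ideal.span (Set.range c)) (c j))),
          𝔔.asIdeal.comap (algebraMap ((Spec (.of (MvPolynomial (Fin 5) k ⧸ Ideal.span (Set.range Gs)))).presheaf.stalk b)
            (Literature.AlgebraicGeometry.Resolution.blowupAlgebra (Ideal.span (Set.range c)) (c j))) =
            IsLocalRing.maximalIdeal ((Spec (.of (MvPolynomial (Fin 5) k ⧸ Ideal.span (Set.range Gs)))).presheaf.stalk b) →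
          IsDomain (Localization.AtPrime 𝔔.asIdeal) ∧ ∀ dd : ℕ, ringKrullDim (Localization.AtPrime 𝔔.asIdeal) = dd →
            ∀ s : Fin dd → Localization.AtPrime 𝔔.asIdeal, (Ideal.span (Set.range s)).radical.IsMaximal →
              RingTheory.Sequence.IsWeaklyRegular (Localization.AtPrime 𝔔.asIdeal) (List.ofFn s) ∧
              ∀ y : Localization.AtPrime 𝔔.asIdeal, (∃ e : ℕ, y ^ 7 ^ e ∈ Ideal.span
                ((fun z : Localization.AtPrime 𝔔.asIdeal => z ^ 7 ^ e) '' (Ideal.span (Set.range s) : Set (Localization.AtPrime 𝔔.asIdeal)))) →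
                y ∈ Ideal.span (Set.range s) := by
  haveI : Fact (Nat.Prime 7) := ⟨by norm_num⟩
  have e : Gs = ![X 2 ^ 2 + (X 1 ^ 2 + X 0 ^ 3) ^ 3 + X 3 ^ 7 + X 4 ^ 8 + X 0 ^ 12] := by
    funext l
    fin_cases l
    exact hG
  subst e
  have hpr := T4HypersurfacePrime.t4_prime_and_X_ne_zero_range k ((![X 2 ^ 2 + (X 1 ^ 2 + X 0 ^ 3) ^ 3 + X 3 ^ 7 + X 4 ^ 8 + X 0 ^ 12] : Fin 1 → MvPolynomial (Fin 5) k)) rfl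
  have hf0 : constantCoeff (X 2 ^ 2 + (X 1 ^ 2 + X 0 ^ 3) ^ 3 + X 3 ^ 7 + X 4 ^ 8 + X 0 ^ 12 : MvPolynomial (Fin 5) k) = 0 := by
    simp [constantCoeff_X]
  exact RoadBFrame.originPointFixable_of_hon 7 k 5 537 T4Char7Fan.ht T4Char7Fan.A T4Char7Fan.hprim T4Char7Fan.hAJ
    T4Char7Fan.m (T4Char7Fan.hcov k) T4Char7Fan.V T4Char7FanHeavy.hV T4Char7Fan.a T4Char7Fan.haA T4Char7FanHeavy.hgen T4Char7FanHeavy.hge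
    (X 2 ^ 2 + (X 1 ^ 2 + X 0 ^ 3) ^ 3 + X 3 ^ 7 + X 4 ^ 8 + X 0 ^ 12) hf0 hpr.1 hpr.2 T4Char7Poly.G T4Char7Fan.d (T4Char7Poly.hθF₀ k) T4Char7Fan.hunit (T4Char7Fan.hzero k _) (hon_all k)

/-- **HEADLINE — THE CRUX STATEMENT FOR `X = T⁽⁴⁾⁺` OVER EVERY FIELD OF CHARACTERISTIC `7`, UNCONDITIONAL**
(`T⁽⁴⁾⁺ = V(Φ − y² − x³, z² + Φ³ + w⁷ + v⁸ + x¹²) ⊂ 𝔸⁶_k`): res-L1-w45a-stub-2's endpoint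
`T4PlusOriginTransport.fInjectiveMacaulayfication_T4plus_char7_of_frame` (door `T4SpecimenDoor` ∘ stalk transport) applied to
`t4_originPointFixable_char7`. [OURS; folklore glue] -/
theorem fInjectiveMacaulayfication_T4plus_char7 (k : Type) [Field k] [CharP k 7] (Fs : Fin 2 → MvPolynomial (Fin 6) k)
    (hF₀ : Fs 0 = X 5 - X 1 ^ 2 - X 0 ^ 3) (hF₁ : Fs 1 = X 2 ^ 2 + X 5 ^ 3 + X 3 ^ 7 + X 4 ^ 8 + X 0 ^ 12) :
    ∃ (X' : Scheme.{0}) (π : X' ⟶ (Spec (.of (MvPolynomial (Fin 6) k ⧸ Ideal.span (Set.range Fs))))), IsProper π ∧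
      Literature.AlgebraicGeometry.Resolution.IsBirational π ∧
      ∀ x : X', IsDomain (X'.presheaf.stalk x) ∧ ∀ d : ℕ, ringKrullDim (X'.presheaf.stalk x) = d →
        ∀ s : Fin d → X'.presheaf.stalk x, (Ideal.span (Set.range s)).radical.IsMaximal →
          RingTheory.Sequence.IsWeaklyRegular (X'.presheaf.stalk x) (List.ofFn s) ∧
          ∀ y : X'.presheaf.stalk x, (∃ e : ℕ, y ^ 7 ^ e ∈
            Ideal.span ((fun z : X'.presheaf.stalk x => z ^ 7 ^ e) '' (Ideal.span (Set.range s) : Set (X'.presheaf.stalk x)))) →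
            y ∈ Ideal.span (Set.range s) :=
  T4PlusOriginTransport.fInjectiveMacaulayfication_T4plus_char7_of_frame (k := k) Fs hF₀ hF₁ (X 2 ^ 2 + (X 1 ^ 2 + X 0 ^ 3) ^ 3 + X 3 ^ 7 + X 4 ^ 8 + X 0 ^ 12) rfl
    (t4_originPointFixable_char7 k _ rfl)

end Summit.ResolutionOfSingularities.ResolutionOfSingularities.Theorems.FInjectiveMacaulayfication.T4OriginPointFixableChar7

end
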